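import Literature.AlgebraicGeometry.Motives.HodgeStructureLefschetzGroupCenterPointsBijection
import Literature.AlgebraicGeometry.Motives.HodgeStructureLefschetzGroupCenterPoints
import Mathlib.RingTheory.Artinian.Module
import HarnessLib

/-!
# `S₀(A)(K)` FOR EVERY FIELD `K ⊇ ℚ`, FIRST KIND: THE CENTRE OF `S(A)(K)` IS FINITE OF ORDER EXACTLY `2^{t_K}`, `t_K` = THE NUMBER
# OF SIMPLE FACTORS OF THE COMMUTATIVE SEMISIMPLE `K`-ALGEBRA `C₀ ⊗_ℚ K` — SO `Z(S(H)(K))` IS FINITE IFF `†` IS OF THE FIRST KIND,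
# FOR EVERY `K` (Milne 1999 §1 p. 645 `S₀(A)(R) = {γ ∈ C₀ ⊗ R | γ†γ = 1}`, Prop. 1.7, Remark 1.6; Moonen–Zarhin 1998 §1 Lemma (1))

[topic AlgebraicGeometry/Motives]

Layer `Literature/AlgebraicGeometry/Motives`, lane `lit-hodgefound` (Track 2 foundations library; prover seat
`lit-hodgefound-p02`, generation 55, self-proposed row g55-#8). THEOREMS ONLY: no definition, no named fact (net debt `0`),
no instance, no notation.  Milne defines `S₀(A)(R) = {γ ∈ C₀(A) ⊗_ℚ R | γ†γ = 1}` for every commutative `ℚ`-algebra `R` (p. 645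
L4–L6), with `C₀(A)` «a product of fields» on each factor of which `†` is the identity or complex conjugation, and proves
`S₀(A)_{/ℚ_ℓ} ≅` the centre of `S_ℓ(A)` through the isomorphism of `ℚ_ℓ`-algebras with involution `C₀(A) ⊗ ℚ_ℓ → C_ℓ(A)`
(Prop. 1.7).  For `†` OF THE FIRST KIND and a FIELD `K ⊇ ℚ` this reads `S₀(K) = {a ∈ C₀ ⊗ K | a² = 1} = μ₂(C₀ ⊗ K)`, and `C₀ ⊗ K`
— a commutative semisimple, hence REDUCED Artinian, `K`-algebra — is a finite product `L₁ × ⋯ × L_{t_K}` of fields of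
characteristic `0`, so `#S₀(K) = 2^{t_K}` (for `K = ℚ`: `t_ℚ = t`, the number of simple factors of `End⁰`, g54-#8).  The tree
has the bijection `Z(S(H)(K)) ≅ S₀(K)` (g54-#10 `Polarization.bijOn_coe_center_lefschetzGroupBaseChange`), `Z(C(H)(K)) = C₀ ⊗ K`
(g54-#2) and the semisimplicity of `C(H)(K) = C(H) ⊗ K` (g54-#2 `isSemisimpleRing_centralizer_endAlg_baseChange`).  Here, with
`Z_K := Z(C(H)(K))` (the `K`-algebra `Subalgebra.center K C(H)(K)`, `C(H)(K) = Z_{End_K(K ⊗ V)}(E_φ ⊗ K)`):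
(i) `Z_K` is REDUCED — a central nilpotent of a semisimple ring is zero (the left ideal it generates is a direct summand) — hence,
being a finite-dimensional commutative `K`-algebra, a finite product of fields (Mathlib's `IsArtinianRing.equivPi` over the
finitely many maximal ideals);
(ii) FIRST KIND: `γ ↦ ↑γ` is a bijection `Z(S(H)(K)) ≅ {z ∈ Z_K | z² = 1}` and `#Z(S(H)(K)) = 2^{t_K}` with
`t_K = #MaxSpec(Z_K)` the number of simple factors of `C₀ ⊗ K`; in particular `Z(S(H)(K))` is FINITE;
(iii) with g54-#10 (`Polarization.adjoint_eq_self_of_finite_center_lefschetzGroupBaseChange`): `Z(S(H)(K))` IS FINITE IFF `†` IS OF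
THE FIRST KIND — for EVERY field `K ⊇ ℚ` (g54-#9 is the case `K = ℚ`), «Semisimple: I–III yes, IV no» uniformly in the coefficients;
(iv) `#Z(S(H)(ℚ)) ≤ #Z(S(H)(K))` over `γ ↦ γ_K` (g54-#10's embedding), whence `t ≤ t_K` (g54-#8 `#Z(S(H)(ℚ)) = 2^t`).

## The sources, verbatim

* J. S. Milne, *Lefschetz classes on abelian varieties*, Duke Math. J. 96 (1999) 639–675 [Milne1999LefschetzClasses] (held
  `paper:doi-10-1215-s0012-7094-99-09620-5`, folio 7): p. 645 L1–L14 "let `C₀(A)` be the centre of the `ℚ`-algebra `End⁰(A)` — it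
  is a product of fields, each of which is either a CM-field or `ℚ`. Every Rosati involution `†` preserves each factor of `C₀(A)`
  and acts on it as complex conjugation. Define `S₀(A)` to be the algebraic group over `ℚ` such that, for all commutative
  `ℚ`-algebras `R`, `S₀(A)(R) = {γ ∈ C₀(A) ⊗_ℚ R | γ†γ = 1}`. Proposition 1.7. The action of `End⁰(A)` on `V_ℓ(A)` induces an
  isomorphism `C₀(A) ⊗_ℚ ℚ_ℓ → C_ℓ(A)` of `ℚ_ℓ`-algebras with involution, and hence an isomorphism of algebraic groups
  `S₀(A)_{/ℚ_ℓ} → S_ℓ(A)`."; Remark 1.6 (p. 644: «`C'(A) ≅ C(A) ⊗_k k'`, `S'(A) ≅ S(A)_{/k'}`»); §2 Summary p. 652.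
* B. J. J. Moonen, Yu. G. Zarhin, *Weil classes on abelian varieties*, J. reine angew. Math. 496 (1998) 83–92
  [MoonenZarhin1998WeilClasses] (held `paper:arxiv-alg-geom_9612017`, chunk p0002 L121–L127): «Lemma. (1) The center of
  `G_div(X)` is the group `U_{K_B}` given by `U_{K_B}(R) = {a ∈ (K_B ⊗_ℚ R)^* ∣ a a† = 1}`. For `X` of type 4 with either `d ≥ 2`
  or `m ≥ 2` this is a connected torus of rank `e₀`; in all other cases it is finite.»
* H. Lange, *Abelian Varieties over the Complex Numbers* (2023) [Lange2023AbelianVarietiesComplex], §2.6.2 Lemma 2.6.4 ∕ 2.6.6.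

Nearest tree results, BY NAME: g54-#2 `isSemisimpleRing_centralizer_endAlg_baseChange`, g53-#5 `finite_centralizer_endAlg_baseChange`,
g54-#4 `Polarization.mem_center_lefschetzGroupBaseChange_iff_mem_center_centralizer`, g54-#6
`Polarization.forall_center_adjointBaseChange_eq_self_iff` ∕ `coe_mul_coe_eq_one_of_mem_center_lefschetzGroupBaseChange`, g54-#10
`Polarization.adjoint_eq_self_of_finite_center_lefschetzGroupBaseChange`, g54-#8 (the case `K = ℚ`: `#Z(S(H)(ℚ)) = 2^t`).

## Dictionary and what is proved (namespace `Literature.AlgebraicGeometry.Motives.HodgeStructure`)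

`S(H)(K) = ψ.lefschetzGroupBaseChange K`, `C(H)(K) = Subalgebra.centralizer K {a_K | a ∈ E_φ}`, `Z_K = Subalgebra.center K C(H)(K)`
(`= C₀ ⊗ K`, g54-#2), `†_K = ψ.adjointBaseChange K`, `t_K = Nat.card (MaximalSpectrum Z_K)`; "first kind" = `∀ z ∈ Z(E_φ), z† = z`.

* §1 **`isReduced_center_centralizer_endAlg_baseChange`** (`Z_K` is reduced), **`finite_maximalSpectrum_center_centralizer_endAlg_baseChange`**.
* §2 **`Polarization.exists_mem_center_lefschetzGroupBaseChange_coe_eq_of_mul_self_eq_one`** (first kind: every `z ∈ Z_K` with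
  `z² = 1` is `↑γ` for a central `γ`), **`Polarization.natCard_center_lefschetzGroupBaseChange_eq_natCard_mul_self_eq_one`**
  (`Z(S(H)(K)) ≅ μ₂(Z_K)`), **`Polarization.natCard_center_lefschetzGroupBaseChange_eq_two_pow`** (`#Z(S(H)(K)) = 2^{t_K}`),
  **`Polarization.finite_center_lefschetzGroupBaseChange_of_forall_adjoint_eq_self`**.
* §3 **`Polarization.finite_center_lefschetzGroupBaseChange_iff`** (finite iff first kind, every `K`),
  **`Polarization.infinite_center_lefschetzGroupBaseChange_iff`**.
* §4 **`Polarization.natCard_center_lefschetzGroup_le_natCard_center_lefschetzGroupBaseChange`** (`#Z(S(H)(ℚ)) ≤ #Z(S(H)(K))`,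
  first kind), **`Polarization.natCard_minimal_stable_le_natCard_maximalSpectrum`** (`t ≤ t_K`).
-/

noncomputable section

open scoped TensorProduct

namespace Literature.AlgebraicGeometry.Motives

namespace HodgeStructure

universe u uK

variable (K : Type uK) [Field K] [Algebra ℚ K] {V : Type u} [AddCommGroup V] [Module ℚ V] [Module.Finite ℚ V] {n : ℤ}
  {H : HodgeStructure V n}

/-! ## §0 Algebra: a central nilpotent of a semisimple ring vanishes; sign vectors in a product of fields -/

omit [Module.Finite ℚ V] in
/-- **A CENTRAL NILPOTENT ELEMENT OF A SEMISIMPLE RING IS ZERO**: the left ideal `R z` has a complement `J` (every left ideal of a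
semisimple ring is a direct summand); writing `1 = e + f`, `e = r z ∈ R z`, `f ∈ J`, the decomposition `z = z e + z f` of `z ∈ R z`
forces `z = z e = (z r) z = r z²` (`z` central), hence `z = r^k z^{k+1}` for all `k`, which vanishes for `k + 1 ≥` the nilpotency
index. [folklore] -/
private theorem eq_zero_of_forall_comm_of_pow_eq_zero₅₅₈ {R : Type*} [Ring R] [IsSemisimpleRing R] {z : R}
    (hz : ∀ r : R, r * z = z * r) {m : ℕ} (hm : z ^ m = 0) : z = 0 := by
  obtain ⟨J, hJ⟩ := exists_isCompl (Submodule.span R ({z} : Set R))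
  -- `1 = e + f`, `e ∈ R z`, `f ∈ J`
  obtain ⟨e, he, f, hf, hef⟩ := Submodule.mem_sup.1 (show (1 : R) ∈ Submodule.span R ({z} : Set R) ⊔ J by
    rw [hJ.sup_eq_top]; exact Submodule.mem_top)
  obtain ⟨r, hr⟩ := Submodule.mem_span_singleton.1 he
  -- `z e = z`: `z = z e + z f` with `z e ∈ R z`, `z f ∈ J`, and `R z ∩ J = 0`
  have hze : z * e = z := by
    have h1 : z * e + z * f = z := by rw [← mul_add, hef, mul_one]
    have hzf : z * f ∈ Submodule.span R ({z} : Set R) ⊓ J := by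
      refine ⟨?_, J.smul_mem z hf⟩
      rw [eq_sub_of_add_eq' h1]
      exact Submodule.sub_mem _ (Submodule.subset_span rfl) ((Submodule.span R ({z} : Set R)).smul_mem z he)
    rw [hJ.inf_eq_bot, Submodule.mem_bot] at hzf
    rw [hzf, add_zero] at h1
    exact h1
  -- `z = r z z`
  have hrz : z = r * z * z := by
    conv_lhs => rw [← hze, ← hr, smul_eq_mul, ← mul_assoc, ← hz r]
  -- `z = r^k z^(k+1)`
  have hk : ∀ k : ℕ, z = r ^ k * z ^ (k + 1) := by
    intro k
    induction k with
    | zero => rw [pow_zero, one_mul, zero_add, pow_one]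
    | succ k ih =>
      calc z = r ^ k * z ^ (k + 1) := ih
        _ = r ^ k * (z * z ^ k) := by rw [pow_succ']
        _ = r ^ k * (r * z * z * z ^ k) := by rw [← hrz]
        _ = r ^ (k + 1) * z ^ (k + 1 + 1) := by rw [pow_succ, pow_succ' z (k + 1), pow_succ' z k]; noncomm_ring
  rw [hk m, pow_succ', hm, mul_zero, mul_zero]

omit [Module.Finite ℚ V] in
/-- In a commutative ring which is a field, `y² = 1 ⟹ y = ±1`. [folklore] -/
private theorem eq_one_or_eq_neg_one_of_mul_self_eq_one₅₅₈ {R : Type*} [CommRing R] (hR : IsField R) {y : R}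
    (hy : y * y = 1) : y = 1 ∨ y = -1 := by
  by_cases h : y - 1 = 0
  · exact Or.inl (sub_eq_zero.1 h)
  · obtain ⟨w, hw⟩ := hR.mul_inv_cancel h
    refine Or.inr (eq_neg_of_add_eq_zero_left ?_)
    calc y + 1 = (y - 1) * w * (y + 1) := by rw [hw, one_mul]
      _ = w * ((y - 1) * (y + 1)) := by ring
      _ = 0 := by rw [show (y - 1) * (y + 1) = 0 by linear_combination hy, mul_zero]

omit [Module.Finite ℚ V] in
/-- **SIGN VECTORS IN A PRODUCT OF FIELDS**: along `ζ : Z ≃+* Π_{k : ι} F_k` with every `F_k` a field in which `1 ≠ -1`, the solutions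
of `z² = 1` in `Z` are exactly the `2^{#ι}` sign vectors. [folklore] -/
private theorem natCard_mul_self_eq_one_eq_two_pow₅₅₈ {Z : Type*} [CommRing Z] {ι : Type*} [Fintype ι] {F : ι → Type*}
    [∀ k, CommRing (F k)] (ζ : Z ≃+* Π k, F k) (hF : ∀ k, IsField (F k)) (hne : ∀ k, (1 : F k) ≠ -1) :
    Nat.card {z : Z // z * z = 1} = 2 ^ Fintype.card ι := by
  classical
  have hsq : ∀ (z : {z : Z // z * z = 1}) (k : ι), ζ z.1 k = 1 ∨ ζ z.1 k = -1 := fun z k =>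
    eq_one_or_eq_neg_one_of_mul_self_eq_one₅₅₈ (hF k) (by rw [← Pi.mul_apply, ← ζ.map_mul, z.2, ζ.map_one, Pi.one_apply])
  -- `z ↦` its sign vector is a bijection onto `ι → Bool`
  let σ : {z : Z // z * z = 1} → (ι → Bool) := fun z k => decide (ζ z.1 k = 1)
  have hinj : Function.Injective σ := by
    intro z z' h
    apply Subtype.ext
    apply ζ.injective
    funext k
    have hk : (ζ z.1 k = 1 ↔ ζ z'.1 k = 1) := decide_eq_decide.1 (congr_fun h k)
    rcases hsq z k with h1 | h1 <;> rcases hsq z' k with h2 | h2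
    · rw [h1, h2]
    · rw [h1, hk.1 h1]
    · rw [hk.2 h2, h2]
    · rw [h1, h2]
  have hsurj : Function.Surjective σ := by
    intro s
    refine ⟨⟨ζ.symm fun k => bif s k then 1 else -1, ζ.injective ?_⟩, funext fun k => ?_⟩
    · rw [ζ.map_mul, ζ.map_one, ζ.apply_symm_apply]
      funext k
      rw [Pi.mul_apply, Pi.one_apply]
      cases s k <;> simp
    · change decide (ζ (ζ.symm fun k => bif s k then 1 else -1) k = 1) = s k
      rw [ζ.apply_symm_apply]
      cases hsk : s k
      · simp only [cond_false, decide_eq_false_iff_not]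
        exact fun h => hne k h.symm
      · simp only [cond_true, decide_true]
  rw [Nat.card_congr (Equiv.ofBijective σ ⟨hinj, hsurj⟩), Nat.card_eq_fintype_card, Fintype.card_fun, Fintype.card_bool]

omit [Algebra ℚ K] [Module.Finite ℚ V] in
/-- **`μ₂` OF A REDUCED FINITE-DIMENSIONAL COMMUTATIVE ALGEBRA over a field of characteristic `≠ 2`** has order `2^t`, `t` the
number of maximal ideals (= simple factors): `Z ≅ Π_{𝔪} Z ⧸ 𝔪` (Mathlib's `IsArtinianRing.equivPi`) and `1 ≠ -1` in each residue
field because `2` is a unit. [folklore] -/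
private theorem natCard_mul_self_eq_one_eq_two_pow_maximalSpectrum₅₅₈ (Z : Type*) [CommRing Z] [Algebra K Z]
    [Module.Finite K Z] [IsReduced Z] (h2 : IsUnit (2 : Z)) :
    Finite (MaximalSpectrum Z) ∧ Nat.card {z : Z // z * z = 1} = 2 ^ Nat.card (MaximalSpectrum Z) := by
  classical
  haveI : IsArtinianRing Z := IsArtinianRing.of_finite K Z
  haveI := Fintype.ofFinite (MaximalSpectrum Z)
  refine ⟨inferInstance, ?_⟩
  rw [Nat.card_eq_fintype_card (α := MaximalSpectrum Z)]
  refine natCard_mul_self_eq_one_eq_two_pow₅₅₈ (IsArtinianRing.equivPi Z).toRingEquiv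
    (fun I => (Ideal.Quotient.maximal_ideal_iff_isField_quotient I.asIdeal).1 I.isMaximal) fun I h => ?_
  haveI := ((Ideal.Quotient.maximal_ideal_iff_isField_quotient I.asIdeal).1 I.isMaximal).nontrivial
  have h3 := h2.map (Ideal.Quotient.mk I.asIdeal)
  rw [map_ofNat, ← one_add_one_eq_two, eq_neg_iff_add_eq_zero.1 h, isUnit_zero_iff] at h3
  exact zero_ne_one h3

omit [Algebra ℚ K] [Module.Finite ℚ V] in
/-- A finite-dimensional commutative algebra over a field has finitely many maximal ideals (it is Artinian). [folklore] -/
private theorem finite_maximalSpectrum_of_finite₅₅₈ (Z : Type*) [CommRing Z] [Algebra K Z] [Module.Finite K Z] :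
    Finite (MaximalSpectrum Z) := by
  haveI : IsArtinianRing Z := IsArtinianRing.of_finite K Z
  infer_instance

/-! ## §1 `Z_K = Z(C(H)(K))` is a reduced finite-dimensional commutative `K`-algebra: a finite product of fields -/

set_option maxSynthPendingDepth 4 in
/-- **THE CENTRE `Z_K = C₀ ⊗ K` OF `C(H)(K)` IS REDUCED** (every field `K ⊇ ℚ`, polarizable `H`): `C(H)(K) = C(H) ⊗ K` is semisimple
(g54-#2), and a central nilpotent of a semisimple ring is zero.  So `Z_K`, a finite-dimensional commutative `K`-algebra, is a
finite product of fields — Milne's «`C₀(A)` is a product of fields», after extension of scalars («`C'(A) ≅ C(A) ⊗_k k'`»).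
[cite: Milne1999LefschetzClasses, §1 p. 645 L1–L14 (C₀, Prop. 1.7) and Remark 1.6 (p. 644)] [cite: Pierce1982, §10.7 Cor. b] -/
theorem isReduced_center_centralizer_endAlg_baseChange (hH : H.IsPolarizable) :
    IsReduced (Subalgebra.center K (Subalgebra.centralizer K
      ((fun a : Module.End ℚ V => a.baseChange K) '' (H.endAlg : Set (Module.End ℚ V))))) := by
  haveI := isSemisimpleRing_centralizer_endAlg_baseChange K H hH
  refine ⟨fun z ⟨m, hm⟩ => ?_⟩
  have hcomm : ∀ r : Subalgebra.centralizer K ((fun a : Module.End ℚ V => a.baseChange K) '' (H.endAlg : Set (Module.End ℚ V))),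
      r * (z : Subalgebra.centralizer K _) = (z : Subalgebra.centralizer K _) * r :=
    fun r => Subalgebra.mem_center_iff.1 z.2 r
  have hm' : ((z : Subalgebra.centralizer K ((fun a : Module.End ℚ V => a.baseChange K) ''
      (H.endAlg : Set (Module.End ℚ V))))) ^ m = 0 := by
    rw [← SubmonoidClass.coe_pow, hm, ZeroMemClass.coe_zero]
  refine Subtype.ext ?_
  rw [ZeroMemClass.coe_zero]
  exact eq_zero_of_forall_comm_of_pow_eq_zero₅₅₈ hcomm hm'

set_option maxSynthPendingDepth 4 in
omit [Module.Finite ℚ V] in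
/-- `2` is a unit of the `K`-algebra `Z_K` (`K ⊇ ℚ`). [folklore] -/
private theorem isUnit_two_center_centralizer₅₅₈ :
    IsUnit (2 : Subalgebra.center K (Subalgebra.centralizer K
      ((fun a : Module.End ℚ V => a.baseChange K) '' (H.endAlg : Set (Module.End ℚ V))))) := by
  have h2K : (2 : K) ≠ 0 := by
    rw [← map_ofNat (algebraMap ℚ K) 2]
    exact (map_ne_zero _).2 two_ne_zero
  rw [← map_ofNat (algebraMap K (Subalgebra.center K (Subalgebra.centralizer K
      ((fun a : Module.End ℚ V => a.baseChange K) '' (H.endAlg : Set (Module.End ℚ V)))))) 2]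
  exact (isUnit_iff_ne_zero.2 h2K).map _

set_option maxSynthPendingDepth 4 in
/-- **`Z_K` HAS FINITELY MANY MAXIMAL IDEALS** (it is a finite-dimensional commutative `K`-algebra, hence Artinian): the simple factors
`L₁, …, L_{t_K}` of `C₀ ⊗ K`. [cite: Milne1999LefschetzClasses, §1 p. 645 L1–L14 and Remark 1.6 (p. 644)] -/
theorem finite_maximalSpectrum_center_centralizer_endAlg_baseChange :
    Finite (MaximalSpectrum (Subalgebra.center K (Subalgebra.centralizer K
      ((fun a : Module.End ℚ V => a.baseChange K) '' (H.endAlg : Set (Module.End ℚ V)))))) := by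
  haveI := finite_centralizer_endAlg_baseChange K H
  haveI : IsNoetherian K (Subalgebra.centralizer K
      ((fun a : Module.End ℚ V => a.baseChange K) '' (H.endAlg : Set (Module.End ℚ V)))) :=
    isNoetherian_of_isNoetherianRing_of_finite K _
  haveI : Module.Finite K (Subalgebra.center K (Subalgebra.centralizer K
      ((fun a : Module.End ℚ V => a.baseChange K) '' (H.endAlg : Set (Module.End ℚ V))))) :=
    Module.Finite.of_injective (Subalgebra.val _).toLinearMap Subtype.val_injective
  exact finite_maximalSpectrum_of_finite₅₅₈ K _

/-! ## §2 First kind: `Z(S(H)(K)) ≅ {z ∈ Z_K | z² = 1}`, of order `2^{t_K}` -/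

set_option maxSynthPendingDepth 4 in
omit [Module.Finite ℚ V] in
/-- `γ ∈ S(H)(K) ⟹ ↑γ ∈ C(H)(K)` («`γ ∈ C(A) ⊗_k R`»). [folklore] -/
private theorem Polarization.coe_mem_centralizer_endAlg_baseChange₅₅₈ (ψ : Polarization H)
    {γ : (K ⊗[ℚ] V) ≃ₗ[K] (K ⊗[ℚ] V)} (hγ : γ ∈ ψ.lefschetzGroupBaseChange K) :
    (γ : Module.End K (K ⊗[ℚ] V)) ∈
      Subalgebra.centralizer K ((fun a : Module.End ℚ V => a.baseChange K) '' (H.endAlg : Set (Module.End ℚ V))) := by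
  rw [Subalgebra.mem_centralizer_iff]
  rintro _ ⟨a, ha, rfl⟩
  exact LinearMap.ext fun x => ((ψ.mem_lefschetzGroupBaseChange_iff γ).1 hγ).1 ⟨a, ha⟩ x

set_option maxSynthPendingDepth 4 in
/-- **FIRST KIND: EVERY `z ∈ Z_K` WITH `z² = 1` IS `↑γ` FOR A (UNIQUE) CENTRAL `γ ∈ S(H)(K)`** — `†_K` is trivial on `Z_K` (g54-#6
`Polarization.forall_center_adjointBaseChange_eq_self_iff`), so `z^{†_K} z = z² = 1`: `z` is a unit of `End_K(K ⊗ V)` lying in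
`C(H)(K)` with `z†z = 1`, i.e. an element of `S(H)(K)` (Milne's definition), central because it lies in `Z(C(H)(K))` (g54-#4).
«`S₀(A)(R) = {γ ∈ C₀ ⊗ R | γ†γ = 1}` → the centre of `S(A)`», surjectivity on `K`-points. [cite: Milne1999LefschetzClasses, §1 p. 644 L16–L18, p. 645 L1–L14 (S₀, Prop. 1.7) and Remark 1.6]
[cite: Lange2023AbelianVarietiesComplex, §2.6.2 Lemma 2.6.4] -/
theorem Polarization.exists_mem_center_lefschetzGroupBaseChange_coe_eq_of_mul_self_eq_one (ψ : Polarization H)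
    (hfix : ∀ z : H.endAlg, z ∈ Subalgebra.center ℚ H.endAlg → ψ.adjoint (z : Module.End ℚ V) = z)
    {z : Subalgebra.centralizer K ((fun a : Module.End ℚ V => a.baseChange K) '' (H.endAlg : Set (Module.End ℚ V)))}
    (hz : z ∈ Subalgebra.center K (Subalgebra.centralizer K
      ((fun a : Module.End ℚ V => a.baseChange K) '' (H.endAlg : Set (Module.End ℚ V)))))
    (hzz : z * z = 1) :
    ∃ γ : ψ.lefschetzGroupBaseChange K, γ ∈ Subgroup.center (ψ.lefschetzGroupBaseChange K) ∧
      ((γ : (K ⊗[ℚ] V) ≃ₗ[K] (K ⊗[ℚ] V)) : Module.End K (K ⊗[ℚ] V)) = z := by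
  have hfixK := (ψ.forall_center_adjointBaseChange_eq_self_iff K).2 hfix z hz
  have hzz' : (z : Module.End K (K ⊗[ℚ] V)) * (z : Module.End K (K ⊗[ℚ] V)) = 1 := by
    rw [← Subalgebra.coe_mul, hzz, Subalgebra.coe_one]
  have hunit : ψ.adjointBaseChange K (z : Module.End K (K ⊗[ℚ] V)) * (z : Module.End K (K ⊗[ℚ] V)) = 1 := by
    rw [hfixK, hzz']
  have hU : IsUnit (z : Module.End K (K ⊗[ℚ] V)) := ⟨⟨_, _, hzz', hzz'⟩, rfl⟩
  obtain ⟨γ₀, hγ₀⟩ : ∃ γ₀ : (K ⊗[ℚ] V) ≃ₗ[K] (K ⊗[ℚ] V), (γ₀ : Module.End K (K ⊗[ℚ] V)) = z :=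
    ⟨LinearMap.GeneralLinearGroup.generalLinearEquiv K (K ⊗[ℚ] V) hU.unit, by
      rw [LinearMap.GeneralLinearGroup.generalLinearEquiv_to_linearMap, IsUnit.unit_spec]⟩
  have hmem : γ₀ ∈ ψ.lefschetzGroupBaseChange K := by
    rw [ψ.mem_lefschetzGroupBaseChange_iff_adjointBaseChange_mul_self_eq_one K, hγ₀]
    refine ⟨fun a x => ?_, hunit⟩
    have h := (Subalgebra.mem_centralizer_iff K).1 z.2 _ ⟨(a : Module.End ℚ V), a.2, rfl⟩
    have hx : ∀ y, γ₀ y = (z : Module.End K (K ⊗[ℚ] V)) y := fun y => by rw [← hγ₀, LinearEquiv.coe_coe]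
    rw [hx, hx, ← Module.End.mul_apply, h, Module.End.mul_apply]
  refine ⟨⟨γ₀, hmem⟩, (ψ.mem_center_lefschetzGroupBaseChange_iff_mem_center_centralizer K ⟨γ₀, hmem⟩).2 ?_, hγ₀⟩
  have hz' : (⟨((⟨γ₀, hmem⟩ : ψ.lefschetzGroupBaseChange K) : (K ⊗[ℚ] V) ≃ₗ[K] (K ⊗[ℚ] V)),
      ψ.coe_mem_centralizer_endAlg_baseChange₅₅₈ K hmem⟩ : Subalgebra.centralizer K
        ((fun a : Module.End ℚ V => a.baseChange K) '' (H.endAlg : Set (Module.End ℚ V)))) = z :=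
    Subtype.ext hγ₀
  rw [hz']
  exact hz

set_option maxSynthPendingDepth 4 in
/-- **FIRST KIND: `Z(S(A)(K)) ≅ S₀(K) = μ₂(C₀ ⊗ K)` AS A COUNT** — `γ ↦ ↑γ` is a bijection from the centre of `S(H)(K)` onto
`{z ∈ Z_K | z² = 1}` (into: g54-#4 «`Z(S(H)(K)) = S(H)(K) ∩ Z(C(H)(K))`» and g54-#6 «central elements are involutions»; onto: the
previous statement). [cite: Milne1999LefschetzClasses, §1 p. 645 L1–L14 (S₀, Prop. 1.7) and Remark 1.6 (p. 644)]
[cite: MoonenZarhin1998WeilClasses, §1 Lemma (1)] -/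
theorem Polarization.natCard_center_lefschetzGroupBaseChange_eq_natCard_mul_self_eq_one (ψ : Polarization H)
    (hfix : ∀ z : H.endAlg, z ∈ Subalgebra.center ℚ H.endAlg → ψ.adjoint (z : Module.End ℚ V) = z) :
    Nat.card (Subgroup.center (ψ.lefschetzGroupBaseChange K)) =
      Nat.card {z : Subalgebra.center K (Subalgebra.centralizer K
        ((fun a : Module.End ℚ V => a.baseChange K) '' (H.endAlg : Set (Module.End ℚ V)))) // z * z = 1} := by
  have hmemC : ∀ γ : Subgroup.center (ψ.lefschetzGroupBaseChange K),
      (((γ : ψ.lefschetzGroupBaseChange K) : (K ⊗[ℚ] V) ≃ₗ[K] (K ⊗[ℚ] V)) : Module.End K (K ⊗[ℚ] V)) ∈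
        Subalgebra.centralizer K ((fun a : Module.End ℚ V => a.baseChange K) '' (H.endAlg : Set (Module.End ℚ V))) :=
    fun γ => ψ.coe_mem_centralizer_endAlg_baseChange₅₅₈ K (γ : ψ.lefschetzGroupBaseChange K).2
  have hmemZ : ∀ γ : Subgroup.center (ψ.lefschetzGroupBaseChange K),
      (⟨_, hmemC γ⟩ : Subalgebra.centralizer K ((fun a : Module.End ℚ V => a.baseChange K) ''
        (H.endAlg : Set (Module.End ℚ V)))) ∈ Subalgebra.center K (Subalgebra.centralizer K
          ((fun a : Module.End ℚ V => a.baseChange K) '' (H.endAlg : Set (Module.End ℚ V)))) := fun γ =>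
    (ψ.mem_center_lefschetzGroupBaseChange_iff_mem_center_centralizer K (γ : ψ.lefschetzGroupBaseChange K)).1 γ.2
  let f : Subgroup.center (ψ.lefschetzGroupBaseChange K) →
      {z : Subalgebra.center K (Subalgebra.centralizer K
        ((fun a : Module.End ℚ V => a.baseChange K) '' (H.endAlg : Set (Module.End ℚ V)))) // z * z = 1} :=
    fun γ => ⟨⟨⟨_, hmemC γ⟩, hmemZ γ⟩,
      Subtype.ext (Subtype.ext (ψ.coe_mul_coe_eq_one_of_mem_center_lefschetzGroupBaseChange K hfix γ.2))⟩
  have hf : ∀ γ : Subgroup.center (ψ.lefschetzGroupBaseChange K),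
      (((f γ).1 : Subalgebra.centralizer K ((fun a : Module.End ℚ V => a.baseChange K) ''
        (H.endAlg : Set (Module.End ℚ V)))) : Module.End K (K ⊗[ℚ] V)) =
        (((γ : ψ.lefschetzGroupBaseChange K) : (K ⊗[ℚ] V) ≃ₗ[K] (K ⊗[ℚ] V)) : Module.End K (K ⊗[ℚ] V)) := fun γ => rfl
  refine Nat.card_congr (Equiv.ofBijective f ⟨fun γ γ' h => ?_, fun z => ?_⟩)
  · have h' := hf γ
    rw [h, hf γ'] at h'
    exact Subtype.ext (Subtype.ext (LinearEquiv.toLinearMap_injective h'.symm))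
  · have hzz : (z.1 : Subalgebra.centralizer K ((fun a : Module.End ℚ V => a.baseChange K) ''
        (H.endAlg : Set (Module.End ℚ V)))) * z.1 = 1 := by
      rw [← Subalgebra.coe_mul, z.2, Subalgebra.coe_one]
    obtain ⟨γ, hγ, hγz⟩ := ψ.exists_mem_center_lefschetzGroupBaseChange_coe_eq_of_mul_self_eq_one K hfix z.1.2 hzz
    refine ⟨⟨γ, hγ⟩, Subtype.ext (Subtype.ext (Subtype.ext ?_))⟩
    rw [hf]
    exact hγz

set_option maxSynthPendingDepth 4 in
/-- **FIRST KIND, EVERY FIELD `K ⊇ ℚ`: `#Z(S(A)(K)) = 2^{t_K}`, `t_K` = THE NUMBER OF SIMPLE FACTORS OF `C₀ ⊗ K`** (= the number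
of maximal ideals of the centre `Z_K` of `C(H)(K)`): `Z(S(H)(K)) ≅ {z ∈ Z_K | z² = 1}` (previous statement) and
`Z_K ≅ L₁ × ⋯ × L_{t_K}` (reduced Artinian, §1; Mathlib's `IsArtinianRing.equivPi`) with fields `L_i` of characteristic `0`, in
which `z² = 1 ⟺ z = ±1` coordinatewise — `S₀(K) = μ₂(C₀ ⊗ K) = {±1}^{t_K}`.  For `K = ℚ` this is g54-#8's `#Z(S(H)(ℚ)) = 2^t`.
[cite: Milne1999LefschetzClasses, §1 p. 645 L1–L14 (S₀, Prop. 1.7), Remark 1.6 (p. 644) and §2 Summary p. 652]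
[cite: MoonenZarhin1998WeilClasses, §1 Lemma (1)] [cite: Lange2023AbelianVarietiesComplex, §2.6.2 Lemma 2.6.4] -/
theorem Polarization.natCard_center_lefschetzGroupBaseChange_eq_two_pow (ψ : Polarization H)
    (hfix : ∀ z : H.endAlg, z ∈ Subalgebra.center ℚ H.endAlg → ψ.adjoint (z : Module.End ℚ V) = z) :
    Nat.card (Subgroup.center (ψ.lefschetzGroupBaseChange K)) =
      2 ^ Nat.card (MaximalSpectrum (Subalgebra.center K (Subalgebra.centralizer K
        ((fun a : Module.End ℚ V => a.baseChange K) '' (H.endAlg : Set (Module.End ℚ V)))))) := by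
  rw [ψ.natCard_center_lefschetzGroupBaseChange_eq_natCard_mul_self_eq_one K hfix]
  haveI := finite_centralizer_endAlg_baseChange K H
  haveI : IsNoetherian K (Subalgebra.centralizer K
      ((fun a : Module.End ℚ V => a.baseChange K) '' (H.endAlg : Set (Module.End ℚ V)))) :=
    isNoetherian_of_isNoetherianRing_of_finite K _
  haveI : Module.Finite K (Subalgebra.center K (Subalgebra.centralizer K
      ((fun a : Module.End ℚ V => a.baseChange K) '' (H.endAlg : Set (Module.End ℚ V))))) :=
    Module.Finite.of_injective (Subalgebra.val _).toLinearMap Subtype.val_injective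
  haveI := isReduced_center_centralizer_endAlg_baseChange K ⟨ψ⟩
  exact (natCard_mul_self_eq_one_eq_two_pow_maximalSpectrum₅₅₈ K (Subalgebra.center K (Subalgebra.centralizer K
    ((fun a : Module.End ℚ V => a.baseChange K) '' (H.endAlg : Set (Module.End ℚ V)))))
      (isUnit_two_center_centralizer₅₅₈ K (H := H))).2

set_option maxSynthPendingDepth 4 in
/-- **FIRST KIND ⟹ `Z(S(A)(K))` IS FINITE FOR EVERY FIELD `K ⊇ ℚ`** (types I–III: `S(A)` semisimple, uniformly in the coefficients).
[cite: Milne1999LefschetzClasses, §1 p. 645 L1–L14, Remark 1.6 and §2 Summary p. 652] [cite: MoonenZarhin1998WeilClasses, §1 Lemma (1)] -/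
theorem Polarization.finite_center_lefschetzGroupBaseChange_of_forall_adjoint_eq_self (ψ : Polarization H)
    (hfix : ∀ z : H.endAlg, z ∈ Subalgebra.center ℚ H.endAlg → ψ.adjoint (z : Module.End ℚ V) = z) :
    Finite (Subgroup.center (ψ.lefschetzGroupBaseChange K)) := by
  apply Nat.finite_of_card_ne_zero
  rw [ψ.natCard_center_lefschetzGroupBaseChange_eq_two_pow K hfix]
  exact pow_ne_zero _ two_ne_zero

/-! ## §3 The dichotomy on `K`-points: finite iff first kind -/

set_option maxSynthPendingDepth 4 in
/-- **`Z(S(A)(K))` IS FINITE IFF `†` IS OF THE FIRST KIND — FOR EVERY FIELD `K ⊇ ℚ`** (`⟸` §2; `⟹` g54-#10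
`Polarization.adjoint_eq_self_of_finite_center_lefschetzGroupBaseChange`).  Milne's Summary «Semisimple: I, II, III yes; IV no» ∕
Moonen–Zarhin's «in all other cases it is finite», for the group of `K`-points with any coefficient field (g54-#9: `K = ℚ`).
[cite: Milne1999LefschetzClasses, §1 p. 645 L1–L14, Remark 1.6 and §2 Summary p. 652] [cite: MoonenZarhin1998WeilClasses, §1 Lemma (1)]
[cite: Lange2023AbelianVarietiesComplex, §2.6.2 Lemma 2.6.4 ∕ 2.6.6] -/
theorem Polarization.finite_center_lefschetzGroupBaseChange_iff (ψ : Polarization H) :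
    Finite (Subgroup.center (ψ.lefschetzGroupBaseChange K)) ↔
      ∀ z : H.endAlg, z ∈ Subalgebra.center ℚ H.endAlg → ψ.adjoint (z : Module.End ℚ V) = z := by
  refine ⟨fun h z hz => ?_, ψ.finite_center_lefschetzGroupBaseChange_of_forall_adjoint_eq_self K⟩
  haveI := h
  exact ψ.adjoint_eq_self_of_finite_center_lefschetzGroupBaseChange K hz

set_option maxSynthPendingDepth 4 in
/-- **`Z(S(A)(K))` IS INFINITE IFF `†` IS OF THE SECOND KIND (type IV), FOR EVERY FIELD `K ⊇ ℚ`.**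
[cite: Milne1999LefschetzClasses, §2 Summary p. 652] [cite: MoonenZarhin1998WeilClasses, §1 Lemma (1)] -/
theorem Polarization.infinite_center_lefschetzGroupBaseChange_iff (ψ : Polarization H) :
    Infinite (Subgroup.center (ψ.lefschetzGroupBaseChange K)) ↔
      ∃ z : H.endAlg, z ∈ Subalgebra.center ℚ H.endAlg ∧ ψ.adjoint (z : Module.End ℚ V) ≠ z := by
  rw [← not_finite_iff_infinite, ψ.finite_center_lefschetzGroupBaseChange_iff K]
  push Not
  exact Iff.rfl

/-! ## §4 Extension of scalars does not shrink the centre: `#Z(S(H)(ℚ)) ≤ #Z(S(H)(K))`, `t ≤ t_K` -/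

set_option maxSynthPendingDepth 4 in
/-- **FIRST KIND: `#Z(S(A)(ℚ)) ≤ #Z(S(A)(K))`** — `γ ↦ γ_K` embeds `Z(S(H)(ℚ))` in `Z(S(H)(K))` (g54-#10
`Polarization.exists_center_lefschetzGroup_to_center_lefschetzGroupBaseChange_injective`, «`S′(A) ≅ S(A)_{/k′}`» on points)
and the target is finite (§2). [cite: Milne1999LefschetzClasses, §1 Remark 1.6 (p. 644) and p. 645 L1–L14] -/
theorem Polarization.natCard_center_lefschetzGroup_le_natCard_center_lefschetzGroupBaseChange (ψ : Polarization H)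
    (hfix : ∀ z : H.endAlg, z ∈ Subalgebra.center ℚ H.endAlg → ψ.adjoint (z : Module.End ℚ V) = z) :
    Nat.card (Subgroup.center ψ.lefschetzGroup) ≤ Nat.card (Subgroup.center (ψ.lefschetzGroupBaseChange K)) := by
  haveI := ψ.finite_center_lefschetzGroupBaseChange_of_forall_adjoint_eq_self K hfix
  obtain ⟨f, hf, -⟩ := ψ.exists_center_lefschetzGroup_to_center_lefschetzGroupBaseChange_injective K
  exact Nat.card_le_card_of_injective f hf

set_option maxSynthPendingDepth 4 in
/-- **FIRST KIND: `t ≤ t_K`** — the number `t` of simple factors of `End⁰` (= minimal non-zero `E_φ`-stable sub-Hodge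
structures, g54-#8 `#Z(S(H)(ℚ)) = 2^t`) is at most the number `t_K` of simple factors of `C₀ ⊗ K` (`#Z(S(H)(K)) = 2^{t_K}`, §2):
each factor `K_i` of `C₀` splits into the simple factors of `K_i ⊗_ℚ K`.
[cite: Milne1999LefschetzClasses, §1 Remark 1.6 (p. 644), p. 645 L1–L14 and §2 Summary p. 652] -/
theorem Polarization.natCard_minimal_stable_le_natCard_maximalSpectrum (ψ : Polarization H)
    (hfix : ∀ z : H.endAlg, z ∈ Subalgebra.center ℚ H.endAlg → ψ.adjoint (z : Module.End ℚ V) = z) :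
    Nat.card {S : SubHodgeStructure H // (∀ a ∈ H.endAlg, ∀ v ∈ S.toSubmodule, a v ∈ S.toSubmodule) ∧
        S.toSubmodule ≠ ⊥ ∧ ∀ S' : SubHodgeStructure H, (∀ a ∈ H.endAlg, ∀ v ∈ S'.toSubmodule, a v ∈ S'.toSubmodule) →
          S'.toSubmodule ≤ S.toSubmodule → S'.toSubmodule = ⊥ ∨ S'.toSubmodule = S.toSubmodule} ≤
      Nat.card (MaximalSpectrum (Subalgebra.center K (Subalgebra.centralizer K
        ((fun a : Module.End ℚ V => a.baseChange K) '' (H.endAlg : Set (Module.End ℚ V)))))) := by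
  have h := ψ.natCard_center_lefschetzGroup_le_natCard_center_lefschetzGroupBaseChange K hfix
  rw [ψ.natCard_center_lefschetzGroup_eq_two_pow hfix, ψ.natCard_center_lefschetzGroupBaseChange_eq_two_pow K hfix] at h
  exact (pow_le_pow_iff_right₀ (by norm_num : (1 : ℕ) < 2)).1 h

end HodgeStructure

end Literature.AlgebraicGeometry.Motives
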